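import Literature.Computability.QuantumComplexity.ControlledHadamard
import Literature.Computability.QuantumComplexity.RestBlockStates
import Literature.Computability.QuantumComplexity.WireConjugation
import Literature.Computability.QuantumComplexity.UniformSubstitution
import Literature.Computability.Complexity.CodeFPArith
import Literature.Computability.QuantumComplexity.CoreDescLayoutFP
import HarnessLib

/-!
# A universal executor: a uniform Clifford+`T` family running the circuit written on its input wires

Topic `Literature/Computability/QuantumComplexity`. In the tree's model of `BQP` (`Cryptography/ClassBQP.lean`:
polynomial-time uniform, oracle-free families of Clifford+`T` circuits, one circuit per input LENGTH,
run on `|x⟩|0…0⟩` and measured on wire `0`) an algorithm whose quantum circuit depends on the input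
`x` itself — "a classical computer generates the quantum circuits to be applied" (Knill–Laflamme's
DQC1; every `FP`-described family of circuits) — is realised by ONE circuit per length that reads a
description of the circuit off its input wires and executes it gate by gate with classically
controlled gates (Nielsen–Chuang 2010, §4.3: controlled operations; §4.5: the circuit model and
uniform families "a classical computer … outputs a description of the circuit"; Arora–Barak 2009,
§6.2 and Thm. 6.15: P-uniform families printed with counters). This file builds that executor
family `UExec.family` and proves its two properties; the sequel (`UniversalExecutorInput.lean`)
supplies the polynomial-time table writer and the random-register front end used for
`DQC1 ⊆ BQP` (`OneCleanQubitProofs.lean`).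

## The construction (`namespace UExec`)

* Layout on inputs of length `ℓ`: size `t = tOf ℓ = ⌊⌊√ℓ⌋^{1/2}⌋` (so `t = t₀` for `ℓ = t₀⁴`), a
  simulated register `R : Fin t ↪ Fin (ℓ + anc ℓ)` whose wire `0` IS the executor's (measured) wire
  `0` and whose wires `i ≥ 1` are the ancillas `ℓ + i`, a work wire `aW = ℓ`, `anc ℓ = t + 1`
  ancillas; the input is a ONE-HOT GATE TABLE: bit `cw ℓ s c = 1 + s · rowW t + c` is the bit of
  slot `s < t`, column `c < rowW t = 3t + t²`; the executor is laid out when `Fits ℓ`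
  (`1 + t · rowW t ≤ ℓ`), and is the empty circuit otherwise.
* Candidates `Cand t` (`H i`, `S i`, `T i`, `C i j`): every oracle-free placed Clifford+`T` gate on
  `t` wires (`Cand.exists_toGate_eq`, `Cand.toGate_injective`), with its column `Cand.col` and the
  duplicate-free complete list `Cand.all` (`mem_all`, `nodup_all`).
* Gadgets (`gadget`): the candidate gate on `R`, controlled by its table wire — the exact
  controlled-Hadamard word `chWord` of `ControlledHadamard.lean`; Toffoli into the work wire, `S`
  or `T` there, uncomputing Toffoli (`sandwich_mulVec_basisState`); a Toffoli for a controlled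
  `CNOT` (`toffoliWord` of `ReversibleCliffordT.lean`). `gadget_mulVec_basisState`,
  `gadget_mulVec_restBlockState`: on block states (`RestBlockStates.lean`) with a clean work wire the
  gadget applies the candidate to the simulated factor iff its bit is set.
* Slots and the circuit: `slotOps`, `applySel`, `RowIs` (row `s` describes the optional gate `o`),
  `applySel_all` (a full slot applies the described gate — one-hot reduction over the nodup complete
  candidate list), `allOps`, `circ`, `family`; `foldl_optApply_getElem?` (the slots read off a gate
  list simulate the list).
* **`acceptProb_circ` / `acceptProbOn_family`**: on a table describing the oracle-free gate list
  `gs` on `t` wires (`|gs| ≤ t`, leading bit `0`), the executor accepts with exactly the probability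
  that `gs`, run on `|0^t⟩`, yields `1` on its wire `0`.
* **`family_isUniform`**: the description `1^ℓ ↦ sigmaEncode ⟨ℓ, anc ℓ, circ ℓ⟩` is polynomial-time
  computable — the raw gate list (`RawGate` of `UniformSubstitution.lean`) is an explicit functional
  program (`rawCirc`; three-wire templates `interp`/`cczT`/`toffoliT`/`chT` for the words;
  `rawGates_circ`) assembled in the typed `FP` algebra `CodeFP` (`Complexity/CodeFP.lean`), as for
  the AJL core family (`CoreDescUniform.lean`); `family_isOracleFree`.

No named facts are introduced; everything is proved.

## References

* M. A. Nielsen, I. L. Chuang, *Quantum Computation and Quantum Information*, CUP 2010, §4.3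
  (controlled operations, Figs. 4.6, 4.9, 4.10), §4.5 (quantum circuit model, uniform families)
  [NielsenChuang2010].
* S. Arora, B. Barak, *Computational Complexity: A Modern Approach*, CUP 2009, §6.2 (P-uniform
  circuit families, Remark 6.7), proof of Thm. 6.15 [AroraBarak2009].
* E. Knill, R. Laflamme, *Power of one bit of quantum information*, Phys. Rev. Lett. 81 (1998)
  5672–5675 (DQC1: "a classical computer generates the quantum circuits") [KnillLaflamme1998].
-/

noncomputable section

namespace Literature.Computability.QuantumComplexity

open _root_.Computability Complexity Cryptography Matrix

namespace UExec

/-! ### Layout -/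

/-- The size parameter of the executor on inputs of length `ℓ`: `t = ⌊⌊√ℓ⌋^{1/2}⌋` (so that
`t = t₀` when `ℓ = t₀⁴`); the simulated register has `t` wires and the table has `t` slots.
[folklore] -/
def tOf (ℓ : ℕ) : ℕ := Nat.sqrt (Nat.sqrt ℓ)

/-- The width of one row (slot) of the gate table for register width `t`: `t` columns for each
of `H`, `S`, `T` and `t²` columns for the `CNOT`s (diagonal columns unused). [folklore] -/
def rowW (t : ℕ) : ℕ := 3 * t + t * t

/-- The table (one leading padding bit, `t` rows) fits into the `ℓ` input wires. [folklore] -/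
def Fits (ℓ : ℕ) : Prop := 1 + tOf ℓ * rowW (tOf ℓ) ≤ ℓ

/-- `Fits` is decidable (an inequality of natural numbers). [folklore] -/
instance : DecidablePred Fits := fun ℓ => inferInstanceAs (Decidable (1 + tOf ℓ * rowW (tOf ℓ) ≤ ℓ))

/-- The number of ancilla wires: the `t - 1` non-answer wires of the simulated register, one
work wire for the controlled-phase gadgets, and one spare (so that the count is positive). [folklore] -/
abbrev anc (ℓ : ℕ) : ℕ := tOf ℓ + 1

/-- `tOf (t⁴) = t`. [folklore] -/
theorem tOf_pow_four (t : ℕ) : tOf (t ^ 4) = t := by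
  rw [tOf, show t ^ 4 = (t * t) * (t * t) by ring, Nat.sqrt_eq, Nat.sqrt_eq]

/-- Under `Fits ℓ` the input is nonempty. [folklore] -/
theorem pos_of_fits {ℓ : ℕ} (h : Fits ℓ) : 0 < ℓ := lt_of_lt_of_le (by omega) (le_trans (Nat.le_add_right 1 _) h)

/-- The position of the table bit of slot `s`, column `c`: `1 + s · rowW t + c`. [folklore] -/
def cw (ℓ s c : ℕ) : ℕ := 1 + s * rowW (tOf ℓ) + c

/-- Table positions are input wires. [folklore] -/
theorem cw_lt {ℓ s c : ℕ} (hF : Fits ℓ) (hs : s < tOf ℓ) (hc : c < rowW (tOf ℓ)) : cw ℓ s c < ℓ := by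
  unfold cw
  unfold Fits at hF
  have h1 : s * rowW (tOf ℓ) + c < tOf ℓ * rowW (tOf ℓ) := by
    calc s * rowW (tOf ℓ) + c < s * rowW (tOf ℓ) + rowW (tOf ℓ) := by omega
      _ = (s + 1) * rowW (tOf ℓ) := by ring
      _ ≤ tOf ℓ * rowW (tOf ℓ) := Nat.mul_le_mul_right _ hs
  omega

variable (ℓ : ℕ)

/-- The simulated register inside the executor: simulated wire `0` IS the executor's wire `0`
(the measured wire; its table bit is the padding bit `0`), simulated wire `i ≥ 1` is the ancilla
wire `ℓ + i`. [folklore] -/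
def R : Fin (tOf ℓ) ↪ Fin (ℓ + anc ℓ) :=
  ⟨fun i => if (i : ℕ) = 0 then ⟨0, by unfold anc; omega⟩ else ⟨ℓ + i, by unfold anc; omega⟩, by
    intro i j hij
    by_cases hi : (i : ℕ) = 0 <;> by_cases hj : (j : ℕ) = 0
    · exact Fin.ext (hi.trans hj.symm)
    · simp only [hi, hj, ↓reduceIte, Fin.mk.injEq] at hij; omega
    · simp only [hi, hj, ↓reduceIte, Fin.mk.injEq] at hij; omega
    · simp only [hi, hj, ↓reduceIte, Fin.mk.injEq] at hij; exact Fin.ext (by omega)⟩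

/-- The value of `R i`. [folklore] -/
theorem val_R (i : Fin (tOf ℓ)) : (R ℓ i : ℕ) = if (i : ℕ) = 0 then 0 else ℓ + i := by
  unfold R
  simp only [Function.Embedding.coeFn_mk]
  split_ifs <;> rfl

/-- The work wire `ℓ` of the controlled-phase gadgets. [folklore] -/
def aW : Fin (ℓ + anc ℓ) := ⟨ℓ, by unfold anc; omega⟩

/-- The value of the work wire. [folklore] -/
@[simp] theorem val_aW : (aW ℓ : ℕ) = ℓ := rfl

variable {ℓ}

/-- The control wire of slot `s`, column `c` (an input wire, under `Fits`). [folklore] -/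
def ctrl (hF : Fits ℓ) (s : Fin (tOf ℓ)) (c : ℕ) (hc : c < rowW (tOf ℓ)) : Fin (ℓ + anc ℓ) :=
  ⟨cw ℓ s c, by have := cw_lt hF s.isLt hc; omega⟩

/-- The value of a control wire. [folklore] -/
@[simp] theorem val_ctrl (hF : Fits ℓ) (s : Fin (tOf ℓ)) (c : ℕ) (hc : c < rowW (tOf ℓ)) :
    (ctrl hF s c hc : ℕ) = cw ℓ s c := rfl

/-- A control wire is not the work wire. [folklore] -/
theorem ctrl_ne_aW (hF : Fits ℓ) (s : Fin (tOf ℓ)) (c : ℕ) (hc : c < rowW (tOf ℓ)) :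
    ctrl hF s c hc ≠ aW ℓ := by
  intro h
  have h' := congrArg Fin.val h
  simp only [val_ctrl, val_aW] at h'
  have := cw_lt hF s.isLt hc
  omega

/-- A control wire is not a register wire. [folklore] -/
theorem ctrl_ne_R (hF : Fits ℓ) (s : Fin (tOf ℓ)) (c : ℕ) (hc : c < rowW (tOf ℓ)) (i : Fin (tOf ℓ)) :
    ctrl hF s c hc ≠ R ℓ i := by
  intro h
  have h' := congrArg Fin.val h
  rw [val_ctrl, val_R] at h'
  have := cw_lt hF s.isLt hc
  unfold cw at h' this
  split_ifs at h' <;> omega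

/-- The work wire is not a register wire (needs `ℓ ≥ 1`, from `Fits`). [folklore] -/
theorem aW_ne_R (hF : Fits ℓ) (i : Fin (tOf ℓ)) : aW ℓ ≠ R ℓ i := by
  intro h
  have h' := congrArg Fin.val h
  rw [val_aW, val_R] at h'
  have := pos_of_fits hF
  split_ifs at h' <;> omega

/-- Distinct simulated wires are distinct executor wires. [folklore] -/
theorem R_ne_R {i j : Fin (tOf ℓ)} (h : i ≠ j) : R ℓ i ≠ R ℓ j := fun h' => h ((R ℓ).injective h')


/-! ### Candidate gates on the simulated register -/

/-- Wire `0` of a Clifford+`T` gate symbol (all arities are positive). [folklore] -/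
def w1 {g : CliffordTOp} : Fin (cliffordT.arity g) := ⟨0, by cases g <;> decide⟩

/-- Wire `1` of the `CNOT` symbol. [folklore] -/
def w2 : Fin (cliffordT.arity CliffordTOp.CNOT) := ⟨1, by decide⟩

/-- `w1 ≠ w2`. [folklore] -/
theorem w1_ne_w2 : (w1 : Fin (cliffordT.arity CliffordTOp.CNOT)) ≠ w2 := by decide

/-- A placed `H` symbol is `hOn` of its wire. [folklore] -/
theorem gate_H_eq {t : ℕ} (e : Fin (cliffordT.arity CliffordTOp.H) ↪ Fin t) :
    (QGate.gate CliffordTOp.H e : QGate cliffordT t) = hOn (e w1) := by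
  unfold hOn; congr 1; ext j; change (e j : ℕ) = e w1; congr 2; exact Subsingleton.elim (α := Fin 1) _ _

/-- A placed `S` symbol is `sOn` of its wire. [folklore] -/
theorem gate_S_eq {t : ℕ} (e : Fin (cliffordT.arity CliffordTOp.S) ↪ Fin t) :
    (QGate.gate CliffordTOp.S e : QGate cliffordT t) = sOn (e w1) := by
  unfold sOn; congr 1; ext j; change (e j : ℕ) = e w1; congr 2; exact Subsingleton.elim (α := Fin 1) _ _

/-- A placed `T` symbol is `tOn` of its wire. [folklore] -/
theorem gate_T_eq {t : ℕ} (e : Fin (cliffordT.arity CliffordTOp.T) ↪ Fin t) :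
    (QGate.gate CliffordTOp.T e : QGate cliffordT t) = tOn (e w1) := by
  unfold tOn; congr 1; ext j; change (e j : ℕ) = e w1; congr 2; exact Subsingleton.elim (α := Fin 1) _ _

/-- A placed `CNOT` symbol is `cnotOn` of its two wires. [folklore] -/
theorem gate_CNOT_eq {t : ℕ} (e : Fin (cliffordT.arity CliffordTOp.CNOT) ↪ Fin t) :
    (QGate.gate CliffordTOp.CNOT e : QGate cliffordT t) =
      cnotOn (e w1) (e w2) (fun h => w1_ne_w2 (e.injective h)) := by
  unfold cnotOn; congr 1; ext j; fin_cases j <;> rfl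

/-- The **candidate gates** on a `t`-wire register: every placed Clifford+`T` gate, indexed by
its symbol and wires. [folklore] -/
inductive Cand (t : ℕ)
  /-- `H` on wire `i` -/
  | H (i : Fin t)
  /-- `S` on wire `i` -/
  | S (i : Fin t)
  /-- `T` on wire `i` -/
  | T (i : Fin t)
  /-- `CNOT` with control `i` and target `j` -/
  | C (i j : Fin t) (h : i ≠ j)
  deriving DecidableEq

namespace Cand

variable {t : ℕ}

/-- The gate of a candidate. [folklore] -/
def toGate : Cand t → QGate cliffordT t
  | H i => hOn i
  | S i => sOn i
  | T i => tOn i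
  | C i j h => cnotOn i j h

/-- Candidate gates are oracle-free. [folklore] -/
theorem toGate_isOracleFree (δ : Cand t) : δ.toGate.IsOracleFree := by
  cases δ <;> exact trivial

/-- The table column of a candidate: `i`, `t + i`, `2t + i`, `3t + i t + j`. [folklore] -/
def col : Cand t → ℕ
  | H i => i
  | S i => t + i
  | T i => 2 * t + i
  | C i j _ => 3 * t + i * t + j

/-- Columns lie in the row. [folklore] -/
theorem col_lt (δ : Cand t) : δ.col < rowW t := by
  cases δ with
  | H i => show (i : ℕ) < 3 * t + t * t; omega
  | S i => show t + (i : ℕ) < 3 * t + t * t; omega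
  | T i => show 2 * t + (i : ℕ) < 3 * t + t * t; omega
  | C i j h =>
    show 3 * t + (i : ℕ) * t + j < 3 * t + t * t
    have hi := i.isLt
    have hj := j.isLt
    have h1 : (i : ℕ) * t + j < t * t := by
      calc (i : ℕ) * t + j < i * t + t := by omega
        _ = (i + 1) * t := by ring
        _ ≤ t * t := Nat.mul_le_mul_right _ hi
    omega

/-- `toGate` is injective. [folklore] -/
theorem toGate_injective : Function.Injective (toGate (t := t)) := by
  intro δ δ' h
  cases δ <;> cases δ' <;>
    simp only [toGate, hOn, sOn, tOn, cnotOn, QGate.gate.injEq, reduceCtorEq, false_and, heq_eq_eq,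
      true_and] at h
  · exact congrArg H (congrArg (fun e => e w1) h :)
  · exact congrArg S (congrArg (fun e => e w1) h :)
  · exact congrArg T (congrArg (fun e => e w1) h :)
  · have h0 : _ = _ := congrArg (fun e => e w1) h
    have h1 : _ = _ := congrArg (fun e => e w2) h
    change _ = _ at h0 h1
    simp only [pairEmb] at h0 h1
    cases h0
    cases h1
    rfl

/-- **Every oracle-free gate is a candidate.** [folklore] -/
theorem exists_toGate_eq (γ : QGate cliffordT t) (hγ : γ.IsOracleFree) : ∃ δ : Cand t, δ.toGate = γ := by
  cases γ with
  | oracle k e => exact absurd hγ id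
  | gate g e =>
    cases g with
    | H => exact ⟨H (e w1), (gate_H_eq e).symm⟩
    | S => exact ⟨S (e w1), (gate_S_eq e).symm⟩
    | T => exact ⟨T (e w1), (gate_T_eq e).symm⟩
    | CNOT => exact ⟨C (e w1) (e w2) fun h => w1_ne_w2 (e.injective h), (gate_CNOT_eq e).symm⟩

/-- The `CNOT` candidates with control `i`. [folklore] -/
def cnots (i : Fin t) : List (Cand t) :=
  (List.finRange t).flatMap fun j => if h : i = j then [] else [C i j h]

/-- The list of all candidates: the `H`, `S`, `T` columns, then the `CNOT` columns row by row.
[folklore] -/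
def all (t : ℕ) : List (Cand t) :=
  (List.finRange t).map H ++ ((List.finRange t).map S ++ ((List.finRange t).map T ++
    (List.finRange t).flatMap cnots))

/-- Membership in `cnots i`. [folklore] -/
theorem mem_cnots {i : Fin t} {δ : Cand t} : δ ∈ cnots i ↔ ∃ j, ∃ h : i ≠ j, δ = C i j h := by
  unfold cnots
  simp only [List.mem_flatMap, List.mem_finRange, true_and]
  constructor
  · rintro ⟨j, hj⟩
    by_cases h : i = j
    · rw [dif_pos h] at hj; simp at hj
    · rw [dif_neg h, List.mem_singleton] at hj; exact ⟨j, h, hj⟩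
  · rintro ⟨j, h, rfl⟩
    exact ⟨j, by rw [dif_neg h]; exact List.mem_singleton_self _⟩

/-- **Every candidate is listed.** [folklore] -/
theorem mem_all (δ : Cand t) : δ ∈ all t := by
  unfold all
  simp only [List.mem_append, List.mem_map, List.mem_finRange, true_and, List.mem_flatMap]
  cases δ with
  | H i => exact Or.inl ⟨i, rfl⟩
  | S i => exact Or.inr (Or.inl ⟨i, rfl⟩)
  | T i => exact Or.inr (Or.inr (Or.inl ⟨i, rfl⟩))
  | C i j h => exact Or.inr (Or.inr (Or.inr ⟨i, mem_cnots.2 ⟨j, h, rfl⟩⟩))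

/-- `cnots i` has no duplicates. [folklore] -/
theorem nodup_cnots (i : Fin t) : (cnots i).Nodup := by
  unfold cnots
  rw [List.nodup_flatMap]
  refine ⟨fun j _ => ?_, ?_⟩
  · split_ifs <;> simp
  · refine List.Pairwise.imp_of_mem ?_ (List.nodup_finRange t)
    intro j j' _ _ hjj δ h1 h2
    by_cases h : i = j
    · simp [h] at h1
    · by_cases h' : i = j'
      · simp [h'] at h2
      · simp only [dif_neg h, List.mem_singleton] at h1
        simp only [dif_neg h', List.mem_singleton] at h2
        rw [h1] at h2
        cases h2
        exact hjj rfl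

/-- **The candidate list has no duplicates.** [folklore] -/
theorem nodup_all (t : ℕ) : (all t).Nodup := by
  have hH : ((List.finRange t).map H).Nodup := (List.nodup_finRange t).map fun _ _ h => by cases h; rfl
  have hS : ((List.finRange t).map S).Nodup := (List.nodup_finRange t).map fun _ _ h => by cases h; rfl
  have hT : ((List.finRange t).map T).Nodup := (List.nodup_finRange t).map fun _ _ h => by cases h; rfl
  have hC : ((List.finRange t).flatMap cnots).Nodup := by
    rw [List.nodup_flatMap]
    refine ⟨fun i _ => nodup_cnots i, List.Pairwise.imp_of_mem ?_ (List.nodup_finRange t)⟩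
    intro i i' _ _ hii δ hδ hδ'
    obtain ⟨j, h, rfl⟩ := mem_cnots.1 hδ
    obtain ⟨j', h', e⟩ := mem_cnots.1 hδ'
    cases e
    exact hii rfl
  have memC : ∀ δ : Cand t, δ ∈ (List.finRange t).flatMap cnots → ∃ i j, ∃ h : i ≠ j, δ = C i j h := by
    intro δ hδ
    obtain ⟨i, -, hi⟩ := List.mem_flatMap.1 hδ
    obtain ⟨j, h, rfl⟩ := mem_cnots.1 hi
    exact ⟨i, j, h, rfl⟩
  unfold all
  refine List.nodup_append.2 ⟨hH, List.nodup_append.2 ⟨hS, List.nodup_append.2 ⟨hT, hC, ?_⟩, ?_⟩, ?_⟩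
  · rintro δ h1 δ' h2 rfl
    obtain ⟨i, -, rfl⟩ := List.mem_map.1 h1
    obtain ⟨i', j, h, e⟩ := memC _ h2
    cases e
  · rintro δ h1 δ' h2 rfl
    obtain ⟨i, -, rfl⟩ := List.mem_map.1 h1
    rcases List.mem_append.1 h2 with h2 | h2
    · obtain ⟨i', -, e⟩ := List.mem_map.1 h2
      cases e
    · obtain ⟨i', j, h, e⟩ := memC _ h2
      cases e
  · rintro δ h1 δ' h2 rfl
    obtain ⟨i, -, rfl⟩ := List.mem_map.1 h1
    rcases List.mem_append.1 h2 with h2 | h2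
    · obtain ⟨i', -, e⟩ := List.mem_map.1 h2
      cases e
    · rcases List.mem_append.1 h2 with h2 | h2
      · obtain ⟨i', -, e⟩ := List.mem_map.1 h2
        cases e
      · obtain ⟨i', j, h, e⟩ := memC _ h2
        cases e

end Cand

/-! ### Transport of the named placed gates -/

section transport

variable {n m : ℕ} (ι : Fin n ↪ Fin m)

/-- Transporting `hOn i` along `ι` gives `hOn (ι i)`. [folklore] -/
theorem mapWiresGate_hOn (i : Fin n) : mapWiresGate ι (hOn i) = hOn (ι i) := rfl

/-- Transporting `sOn i` along `ι` gives `sOn (ι i)`. [folklore] -/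
theorem mapWiresGate_sOn (i : Fin n) : mapWiresGate ι (sOn i) = sOn (ι i) := rfl

/-- Transporting `tOn i` along `ι` gives `tOn (ι i)`. [folklore] -/
theorem mapWiresGate_tOn (i : Fin n) : mapWiresGate ι (tOn i) = tOn (ι i) := rfl

/-- Transporting `cnotOn i j` along `ι` gives `cnotOn (ι i) (ι j)`. [folklore] -/
theorem mapWiresGate_cnotOn (i j : Fin n) (h : i ≠ j) :
    mapWiresGate ι (cnotOn i j h) = cnotOn (ι i) (ι j) (fun e => h (ι.injective e)) := by
  unfold cnotOn mapWiresGate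
  simp only [QGate.gate.injEq, heq_eq_eq, true_and]
  ext k
  fin_cases k <;> rfl

end transport

/-! ### The gadgets: table-controlled gates -/

variable {ℓ : ℕ}

/-- The control (table) wire of slot `s` for the candidate `δ`. [folklore] -/
def cctl (hF : Fits ℓ) (s : Fin (tOf ℓ)) (δ : Cand (tOf ℓ)) : Fin (ℓ + anc ℓ) :=
  ctrl hF s δ.col δ.col_lt

/-- **The gadget of a candidate at slot `s`**: the candidate gate on the simulated register,
controlled by its table wire — a controlled-Hadamard word (Nielsen–Chuang Fig. 4.6), a Toffoli
into the work wire followed by the phase gate there and the uncomputing Toffoli (controlled `S`,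
`T`), or a Toffoli (controlled `CNOT`). [cite: NielsenChuang2010, §4.3 (controlled operations, Figs. 4.6, 4.9)] -/
def gadget (hF : Fits ℓ) (s : Fin (tOf ℓ)) : Cand (tOf ℓ) → List (QGate cliffordT (ℓ + anc ℓ))
  | .H i => chWord (cctl hF s (.H i)) (R ℓ i) (ctrl_ne_R hF s _ _ i)
  | .S i => toffoliWord (cctl hF s (.S i)) (R ℓ i) (aW ℓ) (ctrl_ne_R hF s _ _ i) (ctrl_ne_aW hF s _ _)
        (aW_ne_R hF i).symm ++
      (sOn (aW ℓ) :: toffoliWord (cctl hF s (.S i)) (R ℓ i) (aW ℓ) (ctrl_ne_R hF s _ _ i)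
        (ctrl_ne_aW hF s _ _) (aW_ne_R hF i).symm)
  | .T i => toffoliWord (cctl hF s (.T i)) (R ℓ i) (aW ℓ) (ctrl_ne_R hF s _ _ i) (ctrl_ne_aW hF s _ _)
        (aW_ne_R hF i).symm ++
      (tOn (aW ℓ) :: toffoliWord (cctl hF s (.T i)) (R ℓ i) (aW ℓ) (ctrl_ne_R hF s _ _ i)
        (ctrl_ne_aW hF s _ _) (aW_ne_R hF i).symm)
  | .C i j h => toffoliWord (cctl hF s (.C i j h)) (R ℓ i) (R ℓ j) (ctrl_ne_R hF s _ _ i)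
        (ctrl_ne_R hF s _ _ j) (R_ne_R h)

/-- Gadgets are oracle-free. [folklore] -/
theorem gadget_isOracleFree (hF : Fits ℓ) (s : Fin (tOf ℓ)) (δ : Cand (tOf ℓ)) :
    ∀ g ∈ gadget hF s δ, g.IsOracleFree := by
  intro g hg
  cases δ with
  | H i => exact chWord_isOracleFree _ _ _ g hg
  | S i =>
    simp only [gadget, List.mem_append, List.mem_cons] at hg
    rcases hg with hg | rfl | hg
    · exact toffoliWord_isOracleFree _ _ _ _ _ _ g hg
    · trivial
    · exact toffoliWord_isOracleFree _ _ _ _ _ _ g hg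
  | T i =>
    simp only [gadget, List.mem_append, List.mem_cons] at hg
    rcases hg with hg | rfl | hg
    · exact toffoliWord_isOracleFree _ _ _ _ _ _ g hg
    · trivial
    · exact toffoliWord_isOracleFree _ _ _ _ _ _ g hg
  | C i j h => exact toffoliWord_isOracleFree _ _ _ _ _ _ g hg

/-- A phase gate on the work wire between two Toffolis with controls `v`, `x` and target the work
wire acts, on basis states with a clean work wire, as the phase gate on `x` controlled by `v`
(compute `v ∧ x`, kick the phase, uncompute). [cite: NielsenChuang2010, §4.3 (Fig. 4.10: controlled-U from Toffolis and a work qubit)] -/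
theorem sandwich_mulVec_basisState {v x : Fin (ℓ + anc ℓ)} (hvx : v ≠ x) (hva : v ≠ aW ℓ)
    (hxa : x ≠ aW ℓ) (g : Fin (ℓ + anc ℓ) → QGate cliffordT (ℓ + anc ℓ)) (φ : ℂ)
    (hg : ∀ (y : Fin (ℓ + anc ℓ)) (w : QReg (ℓ + anc ℓ)),
      (g y).toMatrix 0 *ᵥ basisState w = (if w y then φ else 1) • basisState w)
    (w : QReg (ℓ + anc ℓ)) (hw : w (aW ℓ) = false) :
    (⟨toffoliWord v x (aW ℓ) hvx hva hxa ++ (g (aW ℓ) :: toffoliWord v x (aW ℓ) hvx hva hxa)⟩ :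
        QCircuit cliffordT (ℓ + anc ℓ)).toMatrix 0 *ᵥ basisState w =
      if w v then (g x).toMatrix 0 *ᵥ basisState w else basisState w := by
  rw [show (⟨toffoliWord v x (aW ℓ) hvx hva hxa ++ (g (aW ℓ) :: toffoliWord v x (aW ℓ) hvx hva hxa)⟩ :
      QCircuit cliffordT (ℓ + anc ℓ)) = (⟨toffoliWord v x (aW ℓ) hvx hva hxa⟩ : QCircuit cliffordT _).append
        ⟨g (aW ℓ) :: toffoliWord v x (aW ℓ) hvx hva hxa⟩ from rfl,
    QCircuit.toMatrix_append, QCircuit.toMatrix_cons, ← Matrix.mulVec_mulVec, ← Matrix.mulVec_mulVec,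
    toffoliWord_mulVec_basisState, hg, Matrix.mulVec_smul, toffoliWord_mulVec_basisState, hg]
  set w' := Function.update w (aW ℓ) (w (aW ℓ) ^^ (w v && w x)) with hw'
  have h1 : w' (aW ℓ) = (w v && w x) := by rw [hw', Function.update_self, hw, Bool.false_xor]
  have h2 : w' v = w v := by rw [hw', Function.update_of_ne hva]
  have h3 : w' x = w x := by rw [hw', Function.update_of_ne hxa]
  have h4 : Function.update w' (aW ℓ) (w' (aW ℓ) ^^ (w' v && w' x)) = w := by
    rw [h1, h2, h3, Bool.xor_self, hw', Function.update_idem, ← hw, Function.update_eq_self]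
  rw [h4, h1]
  cases w v <;> cases w x <;> simp

/-- The `S` gate on a wire, on basis states (any oracle). [folklore] -/
theorem sOn_mulVec (y : Fin (ℓ + anc ℓ)) (w : QReg (ℓ + anc ℓ)) :
    (sOn y).toMatrix 0 *ᵥ basisState w = (if w y then Complex.I else 1) • basisState w :=
  sOn_mulVec_basisState 0 y w

/-- The `T` gate on a wire, on basis states (any oracle). [folklore] -/
theorem tOn_mulVec (y : Fin (ℓ + anc ℓ)) (w : QReg (ℓ + anc ℓ)) :
    (tOn y).toMatrix 0 *ᵥ basisState w = (if w y then omega else 1) • basisState w :=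
  tOn_mulVec_basisState 0 y w

/-- **The gadget on basis states with a clean work wire**: the candidate gate, transported to the
simulated register, if the table bit is set; the identity otherwise.
[cite: NielsenChuang2010, §4.3 (controlled operations)] -/
theorem gadget_mulVec_basisState (hF : Fits ℓ) (s : Fin (tOf ℓ)) (δ : Cand (tOf ℓ))
    (w : QReg (ℓ + anc ℓ)) (hw : w (aW ℓ) = false) :
    (⟨gadget hF s δ⟩ : QCircuit cliffordT (ℓ + anc ℓ)).toMatrix 0 *ᵥ basisState w =
      if w (cctl hF s δ) then (mapWiresGate (R ℓ) δ.toGate).toMatrix 0 *ᵥ basisState w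
      else basisState w := by
  cases δ with
  | H i =>
    rw [gadget, chWord_mulVec_basisState, Cand.toGate, mapWiresGate_hOn]
  | S i =>
    rw [gadget, sandwich_mulVec_basisState _ _ _ (fun y => sOn y) Complex.I sOn_mulVec w hw, Cand.toGate,
      mapWiresGate_sOn]
  | T i =>
    rw [gadget, sandwich_mulVec_basisState _ _ _ (fun y => tOn y) omega tOn_mulVec w hw, Cand.toGate,
      mapWiresGate_tOn]
  | C i j h =>
    rw [gadget, toffoliWord_mulVec_basisState, Cand.toGate, mapWiresGate_cnotOn, cnotOn_mulVec_basisState]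
    cases hv : w (cctl hF s (Cand.C i j h))
    · simp
    · simp

/-! ### The gadgets on block states -/

/-- The control wires lie off the simulated register. [folklore] -/
theorem cctl_not_mem_range (hF : Fits ℓ) (s : Fin (tOf ℓ)) (δ : Cand (tOf ℓ)) :
    cctl hF s δ ∉ Set.range (R ℓ) := by
  rintro ⟨i, hi⟩
  exact ctrl_ne_R hF s _ _ i hi.symm

/-- The work wire lies off the simulated register. [folklore] -/
theorem aW_not_mem_range (hF : Fits ℓ) : aW ℓ ∉ Set.range (R ℓ) := by
  rintro ⟨i, hi⟩
  exact aW_ne_R hF i hi.symm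

/-- **The gadget on a block state** (simulated register in the state `φ`, all other wires
classical with content `c`, work wire clean): the candidate gate acts on `φ` iff its table bit
`c (cctl s δ)` is set. [cite: NielsenChuang2010, §4.3 (controlled operations)] -/
theorem gadget_mulVec_restBlockState (hF : Fits ℓ) (s : Fin (tOf ℓ)) (δ : Cand (tOf ℓ))
    (φ : QReg (tOf ℓ) → ℂ) {c : QReg (ℓ + anc ℓ)} (hc : c (aW ℓ) = false) :
    (⟨gadget hF s δ⟩ : QCircuit cliffordT (ℓ + anc ℓ)).toMatrix 0 *ᵥ restBlockState (R ℓ) φ c =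
      restBlockState (R ℓ) (if c (cctl hF s δ) then δ.toGate.toMatrix 0 *ᵥ φ else φ) c := by
  have key : ∀ f : QReg (tOf ℓ),
      (⟨gadget hF s δ⟩ : QCircuit cliffordT (ℓ + anc ℓ)).toMatrix 0 *ᵥ basisState (Function.extend (R ℓ) f c) =
        if c (cctl hF s δ) then placeGate (R ℓ) (δ.toGate.toMatrix 0) *ᵥ basisState (Function.extend (R ℓ) f c)
        else basisState (Function.extend (R ℓ) f c) := by
    intro f
    rw [gadget_mulVec_basisState hF s δ _ (by rw [extend_apply_of_not_mem _ _ _ (aW_not_mem_range hF), hc]),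
      extend_apply_of_not_mem _ _ _ (cctl_not_mem_range hF s δ), toMatrix_mapWiresGate]
  rw [restBlockState_eq_sum, Matrix.mulVec_sum]
  simp_rw [Matrix.mulVec_smul, key]
  by_cases hbit : c (cctl hF s δ)
  · simp_rw [if_pos hbit, ← Matrix.mulVec_smul]
    rw [← Matrix.mulVec_sum, ← restBlockState_eq_sum, placeGate_mulVec_restBlockState]
  · simp_rw [if_neg hbit]
    rw [← restBlockState_eq_sum]

/-! ### One slot: the gadgets of all candidates -/

/-- The gate list of slot `s` restricted to the candidates `L`. [folklore] -/
def slotOps (hF : Fits ℓ) (s : Fin (tOf ℓ)) (L : List (Cand (tOf ℓ))) : List (QGate cliffordT (ℓ + anc ℓ)) :=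
  L.flatMap (gadget hF s)

/-- The action of the candidates `L` of slot `s` on the simulated register, read off the table
bits of `c`: apply, in order, every candidate whose bit is set. [folklore] -/
def applySel (hF : Fits ℓ) (s : Fin (tOf ℓ)) (c : QReg (ℓ + anc ℓ)) :
    List (Cand (tOf ℓ)) → (QReg (tOf ℓ) → ℂ) → (QReg (tOf ℓ) → ℂ)
  | [], φ => φ
  | δ :: L, φ => applySel hF s c L (if c (cctl hF s δ) then δ.toGate.toMatrix 0 *ᵥ φ else φ)

/-- **A slot on a block state** applies `applySel`. [folklore] -/
theorem slotOps_mulVec_restBlockState (hF : Fits ℓ) (s : Fin (tOf ℓ)) {c : QReg (ℓ + anc ℓ)}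
    (hc : c (aW ℓ) = false) (L : List (Cand (tOf ℓ))) (φ : QReg (tOf ℓ) → ℂ) :
    (⟨slotOps hF s L⟩ : QCircuit cliffordT (ℓ + anc ℓ)).toMatrix 0 *ᵥ restBlockState (R ℓ) φ c =
      restBlockState (R ℓ) (applySel hF s c L φ) c := by
  induction L generalizing φ with
  | nil => simp [slotOps, applySel]
  | cons δ L ih =>
    rw [slotOps, List.flatMap_cons, show (⟨gadget hF s δ ++ L.flatMap (gadget hF s)⟩ : QCircuit cliffordT _) =
        (⟨gadget hF s δ⟩ : QCircuit cliffordT _).append ⟨slotOps hF s L⟩ from rfl, QCircuit.toMatrix_append,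
      ← Matrix.mulVec_mulVec, gadget_mulVec_restBlockState hF s δ φ hc, ih]
    rfl

/-- **The table row of slot `s` describes the gate `o`**: the bit of candidate `δ` is set iff
`o` is the gate of `δ` (so at most one bit of the row is set, none if `o = none`). [folklore] -/
def RowIs (hF : Fits ℓ) (s : Fin (tOf ℓ)) (c : QReg (ℓ + anc ℓ)) (o : Option (QGate cliffordT (tOf ℓ))) : Prop :=
  ∀ δ : Cand (tOf ℓ), c (cctl hF s δ) = true ↔ o = some δ.toGate

/-- An empty row acts as the identity. [folklore] -/
theorem applySel_of_none (hF : Fits ℓ) (s : Fin (tOf ℓ)) {c : QReg (ℓ + anc ℓ)} (h : RowIs hF s c none)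
    (L : List (Cand (tOf ℓ))) (φ : QReg (tOf ℓ) → ℂ) : applySel hF s c L φ = φ := by
  induction L generalizing φ with
  | nil => rfl
  | cons δ L ih =>
    have hδ : c (cctl hF s δ) = false := by
      cases hb : c (cctl hF s δ)
      · rfl
      · exact absurd ((h δ).1 hb) (by simp)
    rw [applySel, hδ]
    exact ih _

/-- A row describing the gate of `δ₀` applies that gate once if `δ₀` is among the (distinct)
candidates `L`, and nothing otherwise. [folklore] -/
theorem applySel_of_some (hF : Fits ℓ) (s : Fin (tOf ℓ)) {c : QReg (ℓ + anc ℓ)} {δ₀ : Cand (tOf ℓ)}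
    (h : RowIs hF s c (some δ₀.toGate)) (L : List (Cand (tOf ℓ))) (hL : L.Nodup) (φ : QReg (tOf ℓ) → ℂ) :
    applySel hF s c L φ = if δ₀ ∈ L then δ₀.toGate.toMatrix 0 *ᵥ φ else φ := by
  induction L generalizing φ with
  | nil => simp [applySel]
  | cons δ L ih =>
    have hnd := List.nodup_cons.1 hL
    rw [applySel, ih hnd.2]
    by_cases hδ : δ = δ₀
    · subst hδ
      have hbit : c (cctl hF s δ) = true := (h δ).2 rfl
      rw [if_pos hbit, if_neg hnd.1, if_pos List.mem_cons_self]
    · have hbit : c (cctl hF s δ) = false := by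
        cases hb : c (cctl hF s δ)
        · rfl
        · exact absurd (Cand.toGate_injective (Option.some_injective _ ((h δ).1 hb))).symm hδ
      rw [hbit]
      simp only [Bool.false_eq_true, ↓reduceIte, List.mem_cons]
      by_cases hm : δ₀ ∈ L
      · rw [if_pos hm, if_pos (Or.inr hm)]
      · rw [if_neg hm, if_neg]
        rintro (e | e)
        · exact hδ e.symm
        · exact hm e

/-- The action of an optional gate. [folklore] -/
def optApply (o : Option (QGate cliffordT (tOf ℓ))) (φ : QReg (tOf ℓ) → ℂ) : QReg (tOf ℓ) → ℂ :=
  match o with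
  | none => φ
  | some γ => γ.toMatrix 0 *ᵥ φ

/-- **A full slot applies the described gate** (all candidates, in the fixed order `Cand.all`).
[folklore] -/
theorem applySel_all (hF : Fits ℓ) (s : Fin (tOf ℓ)) {c : QReg (ℓ + anc ℓ)} {o : Option (QGate cliffordT (tOf ℓ))}
    (ho : ∀ γ, o = some γ → γ.IsOracleFree) (h : RowIs hF s c o) (φ : QReg (tOf ℓ) → ℂ) :
    applySel hF s c (Cand.all (tOf ℓ)) φ = optApply o φ := by
  cases o with
  | none => exact applySel_of_none hF s h _ φ
  | some γ =>
    obtain ⟨δ₀, rfl⟩ := Cand.exists_toGate_eq γ (ho γ rfl)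
    rw [applySel_of_some hF s h _ (Cand.nodup_all _) φ, if_pos (Cand.mem_all δ₀)]
    rfl

/-! ### All slots -/

/-- **The gate list of the executor** (under `Fits`): slot after slot, all candidate gadgets.
[folklore] -/
def allOps (hF : Fits ℓ) : List (QGate cliffordT (ℓ + anc ℓ)) :=
  (List.finRange (tOf ℓ)).flatMap fun s => slotOps hF s (Cand.all (tOf ℓ))

/-- The executor's gates are oracle-free. [folklore] -/
theorem allOps_isOracleFree (hF : Fits ℓ) : ∀ g ∈ allOps hF, g.IsOracleFree := by
  intro g hg
  simp only [allOps, slotOps, List.mem_flatMap] at hg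
  obtain ⟨s, -, δ, -, hg⟩ := hg
  exact gadget_isOracleFree hF s δ g hg

/-- Slot after slot on a block state. [folklore] -/
theorem flatMap_slotOps_mulVec_restBlockState (hF : Fits ℓ) {c : QReg (ℓ + anc ℓ)} (hc : c (aW ℓ) = false)
    (slotGate : Fin (tOf ℓ) → Option (QGate cliffordT (tOf ℓ)))
    (hfree : ∀ s γ, slotGate s = some γ → γ.IsOracleFree) (hrows : ∀ s, RowIs hF s c (slotGate s))
    (S : List (Fin (tOf ℓ))) (φ : QReg (tOf ℓ) → ℂ) :
    (⟨S.flatMap fun s => slotOps hF s (Cand.all (tOf ℓ))⟩ : QCircuit cliffordT (ℓ + anc ℓ)).toMatrix 0 *ᵥ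
        restBlockState (R ℓ) φ c =
      restBlockState (R ℓ) (S.foldl (fun ψ s => optApply (slotGate s) ψ) φ) c := by
  induction S generalizing φ with
  | nil => simp
  | cons s S ih =>
    rw [List.flatMap_cons, show (⟨slotOps hF s (Cand.all (tOf ℓ)) ++ S.flatMap fun s => slotOps hF s (Cand.all (tOf ℓ))⟩ :
        QCircuit cliffordT _) = (⟨slotOps hF s (Cand.all (tOf ℓ))⟩ : QCircuit cliffordT _).append
          ⟨S.flatMap fun s => slotOps hF s (Cand.all (tOf ℓ))⟩ from rfl, QCircuit.toMatrix_append,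
      ← Matrix.mulVec_mulVec, slotOps_mulVec_restBlockState hF s hc, applySel_all hF s (hfree s) (hrows s), ih,
      List.foldl_cons]

/-! ### From optional slot gates to the simulated circuit -/

/-- A circuit acts on a state vector gate by gate (head first). [folklore] -/
theorem toMatrix_mulVec_eq_foldl {n : ℕ} (A : Language Bool) (gs : List (QGate cliffordT n)) (φ : QReg n → ℂ) :
    (⟨gs⟩ : QCircuit cliffordT n).toMatrix A *ᵥ φ = gs.foldl (fun ψ γ => γ.toMatrix A *ᵥ ψ) φ := by
  induction gs generalizing φ with
  | nil => simp
  | cons γ gs ih => rw [QCircuit.toMatrix_cons, ← Matrix.mulVec_mulVec, ih, List.foldl_cons]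

/-- Reading a list at the indices `0, …, t - 1 ≥ |gs| - 1`: the entries, then `none`s. [folklore] -/
theorem map_getElem?_range {α : Type*} (gs : List α) {t : ℕ} (h : gs.length ≤ t) :
    (List.range t).map (fun n => gs[n]?) = gs.map some ++ List.replicate (t - gs.length) none := by
  apply List.ext_getElem
  · simp only [List.length_map, List.length_range, List.length_append, List.length_replicate]; omega
  · intro n h1 h2
    rw [List.length_map, List.length_range] at h1
    rw [List.getElem_map, List.getElem_range]
    by_cases hn : n < gs.length
    · rw [List.getElem_append_left (by simpa using hn), List.getElem_map, List.getElem?_eq_getElem hn]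
    · rw [List.getElem_append_right (by simpa using hn), List.getElem_replicate,
        List.getElem?_eq_none_iff.2 (by omega)]

/-- Folding identity steps. [folklore] -/
theorem foldl_replicate_none {β γ : Type*} (F : β → Option γ → β) (hF : ∀ b, F b none = b) (k : ℕ) (b : β) :
    (List.replicate k (none : Option γ)).foldl F b = b := by
  induction k generalizing b with
  | zero => rfl
  | succ k ih => rw [List.replicate_succ, List.foldl_cons, hF, ih]

/-- **The slots read off a gate list simulate the circuit**: applying, for `s = 0, …, t-1`, the
optional gate `gs[s]?` is applying the circuit `gs` (`|gs| ≤ t`). [folklore] -/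
theorem foldl_optApply_getElem? (gs : List (QGate cliffordT (tOf ℓ))) (h : gs.length ≤ tOf ℓ)
    (φ : QReg (tOf ℓ) → ℂ) :
    (List.finRange (tOf ℓ)).foldl (fun ψ (s : Fin (tOf ℓ)) => optApply gs[(s : ℕ)]? ψ) φ =
      (⟨gs⟩ : QCircuit cliffordT (tOf ℓ)).toMatrix 0 *ᵥ φ := by
  have h1 : (List.finRange (tOf ℓ)).foldl (fun ψ (s : Fin (tOf ℓ)) => optApply gs[(s : ℕ)]? ψ) φ =
      ((List.range (tOf ℓ)).map fun n => gs[n]?).foldl (fun ψ o => optApply o ψ) φ := by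
    rw [← List.map_coe_finRange_eq_range, List.map_map, List.foldl_map]
    rfl
  rw [h1, map_getElem?_range gs h, List.foldl_append, List.foldl_map,
    foldl_replicate_none _ (fun _ => rfl), toMatrix_mulVec_eq_foldl]
  rfl

/-! ### The executor family and its acceptance probability -/

variable (ℓ) in
/-- **The executor circuit** on inputs of length `ℓ`: all slots (under `Fits ℓ`; the empty
circuit otherwise). [folklore] -/
def circ : QCircuit cliffordT (ℓ + anc ℓ) :=
  if hF : Fits ℓ then ⟨allOps hF⟩ else ⟨[]⟩

/-- **The universal executor family.** [folklore] -/
def family : QCircuitFamily cliffordT := ⟨anc, circ⟩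

/-- The executor family is oracle-free. [folklore] -/
theorem family_isOracleFree : family.IsOracleFree := by
  intro ℓ g hg
  change g ∈ (circ ℓ).gates at hg
  unfold circ at hg
  split_ifs at hg with hF
  · exact allOps_isOracleFree hF g hg
  · exact absurd hg List.not_mem_nil

/-- The padded input restricted to the simulated register is `|0…0⟩` when the leading table
bit is `0`. [folklore] -/
theorem padInput_comp_R (hF : Fits ℓ) (T : QReg ℓ) (h0 : T ⟨0, pos_of_fits hF⟩ = false) :
    padInput T (anc ℓ) ∘ R ℓ = fun _ => false := by
  funext i
  simp only [Function.comp_apply]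
  by_cases hi : (i : ℕ) = 0
  · have hR : R ℓ i = Fin.castAdd (anc ℓ) ⟨0, pos_of_fits hF⟩ := Fin.ext (by rw [val_R, if_pos hi]; rfl)
    rw [hR, padInput, Fin.append_left]
    exact h0
  · have hR : R ℓ i = Fin.natAdd ℓ ⟨i, by unfold anc; omega⟩ := Fin.ext (by rw [val_R, if_neg hi]; rfl)
    rw [hR, padInput, Fin.append_right]

/-- The work wire of the padded input is clean. [folklore] -/
theorem padInput_aW (T : QReg ℓ) : padInput T (anc ℓ) (aW ℓ) = false := by
  have hR : aW ℓ = Fin.natAdd ℓ ⟨0, by unfold anc; omega⟩ := Fin.ext (by simp)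
  rw [hR, padInput, Fin.append_right]

/-- **The acceptance probability of the executor.** If the input `T` (of length `ℓ`, `Fits ℓ`,
`t = tOf ℓ ≥ 1`) has leading bit `0` and its rows describe the oracle-free gate list `gs` on `t`
wires (`|gs| ≤ t`; row `s` has the bit of candidate `δ` set iff `gs[s] = δ.toGate`), then the
executor accepts `T` with exactly the probability that `gs`, run on `|0^t⟩`, yields `1` on its
wire `0`. [cite: NielsenChuang2010, §4.3 and §4.5 (controlled operations; the circuit model)] -/
theorem acceptProb_circ (hF : Fits ℓ) (ht : 0 < tOf ℓ) (gs : List (QGate cliffordT (tOf ℓ)))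
    (hlen : gs.length ≤ tOf ℓ) (hfree : ∀ γ ∈ gs, γ.IsOracleFree) (T : QReg ℓ)
    (hrows : ∀ s : Fin (tOf ℓ), RowIs hF s (padInput T (anc ℓ)) gs[(s : ℕ)]?)
    (h0 : T ⟨0, pos_of_fits hF⟩ = false) :
    (circ ℓ).acceptProb 0 T =
      (⟨gs⟩ : QCircuit cliffordT (tOf ℓ)).probEvent 0 (basisState fun _ => false) (QCircuit.acceptEvent (tOf ℓ)) := by
  classical
  set c : QReg (ℓ + anc ℓ) := padInput T (anc ℓ) with hc
  set ψ : QReg (tOf ℓ) → ℂ := (⟨gs⟩ : QCircuit cliffordT (tOf ℓ)).toMatrix 0 *ᵥ basisState (fun _ => false) with hψ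
  -- the output state of the executor
  have hrun : (circ ℓ).runOn 0 (basisState c) = restBlockState (R ℓ) ψ c := by
    have hfree' : ∀ (s : Fin (tOf ℓ)) γ, gs[(s : ℕ)]? = some γ → γ.IsOracleFree := fun s γ hγ =>
      hfree γ (List.mem_of_getElem? hγ)
    rw [QCircuit.runOn, circ, dif_pos hF, basisState_eq_restBlockState (R ℓ) c, padInput_comp_R hF T h0, allOps,
      flatMap_slotOps_mulVec_restBlockState hF (padInput_aW T) (fun s => gs[(s : ℕ)]?) hfree' hrows,
      foldl_optApply_getElem? gs hlen]
  -- the measured event, read on the simulated register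
  have hev : ∀ y : QReg (ℓ + anc ℓ), y ∈ QCircuit.acceptEvent (ℓ + anc ℓ) ↔ (y ∘ R ℓ) ⟨0, ht⟩ = true := by
    intro y
    have hR : R ℓ ⟨0, ht⟩ = ⟨0, by have := pos_of_fits hF; omega⟩ := Fin.ext (by rw [val_R, if_pos rfl])
    simp only [QCircuit.acceptEvent, Set.mem_setOf_eq, Function.comp_apply, hR]
    exact ⟨fun ⟨_, h⟩ => h, fun h => ⟨by have := pos_of_fits hF; omega, h⟩⟩
  have hev' : ∀ f : QReg (tOf ℓ), f ∈ QCircuit.acceptEvent (tOf ℓ) ↔ f ⟨0, ht⟩ = true := fun f =>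
    ⟨fun ⟨_, h⟩ => h, fun h => ⟨ht, h⟩⟩
  rw [QCircuit.acceptProb_eq_probEvent, QCircuit.probEvent, QCircuit.probEvent, Finset.sum_filter, Finset.sum_filter,
    ← hc, hrun, QCircuit.runOn, ← hψ]
  have hterm : ∀ y : QReg (ℓ + anc ℓ), (if y ∈ QCircuit.acceptEvent (ℓ + anc ℓ) then ‖restBlockState (R ℓ) ψ c y‖ ^ 2 else 0) =
      if AgreeOff (R ℓ) y c then (if (y ∘ R ℓ) ⟨0, ht⟩ = true then ‖ψ (y ∘ R ℓ)‖ ^ 2 else 0) else 0 := by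
    intro y
    rw [restBlockState_apply, hev]
    by_cases ha : AgreeOff (R ℓ) y c
    · rw [if_pos ha, if_pos ha]
      split_ifs <;> rfl
    · rw [if_neg ha, if_neg ha]; simp
  simp_rw [hterm]
  rw [sum_ite_agreeOff_eq_sum_extend]
  refine Finset.sum_congr rfl fun f _ => ?_
  rw [extend_comp_embedding, hev' f]
  split_ifs <;> rfl

/-- **The acceptance probability of the executor family** on a table `T` (list form).
[cite: NielsenChuang2010, §4.5 (the quantum circuit model)] -/
theorem acceptProbOn_family (T : List Bool) (hF : Fits T.length) (ht : 0 < tOf T.length)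
    (gs : List (QGate cliffordT (tOf T.length))) (hlen : gs.length ≤ tOf T.length) (hfree : ∀ γ ∈ gs, γ.IsOracleFree)
    (hrows : ∀ (s : Fin (tOf T.length)) (δ : Cand (tOf T.length)),
      T.getD (cw T.length s δ.col) false = true ↔ gs[(s : ℕ)]? = some δ.toGate)
    (h0 : T.getD 0 false = false) :
    family.acceptProbOn 0 T =
      (⟨gs⟩ : QCircuit cliffordT (tOf T.length)).probEvent 0 (basisState fun _ => false)
        (QCircuit.acceptEvent (tOf T.length)) := by
  have hget : ∀ (v : ℕ) (hv : v < T.length), padInput T.get (anc T.length) ⟨v, by omega⟩ = T.getD v false := by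
    intro v hv
    rw [show (⟨v, by omega⟩ : Fin (T.length + anc T.length)) = Fin.castAdd (anc T.length) ⟨v, hv⟩ from rfl,
      padInput, Fin.append_left, List.getD_eq_getElem _ _ hv, List.get_eq_getElem]
  refine acceptProb_circ hF ht gs hlen hfree T.get (fun s δ => ?_) ?_
  · rw [← hrows s δ, ← hget _ (cw_lt hF s.isLt δ.col_lt)]
    rfl
  · rw [List.getD_eq_getElem _ _ (pos_of_fits hF)] at h0
    rw [List.get_eq_getElem]
    exact h0

/-! ### Raw descriptions of the gadgets: three-wire templates -/

section Raw

/-- A **template instruction** `(o, x, y)`: opcode `o` (`0 = H`, `1 = S`, `2 = T` on the wire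
selected by `x`; `3 = CNOT` from the wire selected by `x` to the one selected by `y`), the selectors
ranging over three wire slots. [folklore] -/
abbrev Tmpl : Type := ℕ × ℕ × ℕ

/-- Selecting one of three wires. [folklore] -/
def sel (w : ℕ × ℕ × ℕ) (x : ℕ) : ℕ := if x = 0 then w.1 else if x = 1 then w.2.1 else w.2.2

/-- The raw gate of a template instruction on the wires `w`. [folklore] -/
def interp (w : ℕ × ℕ × ℕ) (τ : Tmpl) : RawGate :=
  if τ.1 = 3 then (false, 3, [sel w τ.2.1, sel w τ.2.2]) else (false, τ.1, [sel w τ.2.1])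

/-- The template of `cczWord a b c` (wires `a = 0`, `b = 1`, `c = 2`). [folklore] -/
def cczT : List Tmpl :=
  [(2, 0, 0), (2, 1, 0), (2, 2, 0), (3, 0, 1), (1, 1, 0), (1, 1, 0), (1, 1, 0), (2, 1, 0), (3, 1, 2), (2, 2, 0),
   (3, 0, 2), (1, 2, 0), (1, 2, 0), (1, 2, 0), (2, 2, 0), (3, 1, 2), (1, 2, 0), (1, 2, 0), (1, 2, 0), (2, 2, 0),
   (3, 0, 2), (3, 0, 1)]

/-- The template of `toffoliWord a b c`. [folklore] -/
def toffoliT : List Tmpl := (0, 2, 0) :: (cczT ++ [(0, 2, 0)])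

/-- The template of `chWord c a` (control `c = 0`, target `a = 1`). [folklore] -/
def chT : List Tmpl :=
  [(1, 1, 0), (1, 1, 0), (1, 1, 0), (0, 1, 0), (1, 1, 0), (1, 1, 0), (1, 1, 0), (2, 1, 0), (0, 1, 0), (1, 1, 0)] ++
    ([(0, 1, 0), (3, 0, 1), (0, 1, 0)] ++ [(1, 1, 0), (1, 1, 0), (1, 1, 0), (0, 1, 0), (2, 1, 0), (0, 1, 0), (1, 1, 0)])

variable {N : ℕ}

/-- The raw `CCZ` word. [folklore] -/
theorem map_toRaw_cczWord (a b c : Fin N) (hab : a ≠ b) (hac : a ≠ c) (hbc : b ≠ c) :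
    (cczWord a b c hab hac hbc).map QGate.toRaw = cczT.map (interp (a, b, c)) := rfl

/-- The raw Toffoli word. [folklore] -/
theorem map_toRaw_toffoliWord (a b c : Fin N) (hab : a ≠ b) (hac : a ≠ c) (hbc : b ≠ c) :
    (toffoliWord a b c hab hac hbc).map QGate.toRaw = toffoliT.map (interp (a, b, c)) := rfl

/-- The raw controlled-Hadamard word (the third wire slot is not used). [folklore] -/
theorem map_toRaw_chWord (c a : Fin N) (h : c ≠ a) (z : ℕ) :
    (chWord c a h).map QGate.toRaw = chT.map (interp (c, a, z)) := rfl

end Raw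

/-! ### The raw description of the executor -/

section RawExec

variable (ℓ : ℕ)

/-- The value of the simulated wire `i`. [folklore] -/
def rVal (i : ℕ) : ℕ := if i = 0 then 0 else ℓ + i

/-- Raw controlled-`H` gadget of slot `s`, wire `i`. [folklore] -/
def rawGH (s i : ℕ) : List RawGate := chT.map (interp (cw ℓ s i, rVal ℓ i, 0))

/-- Raw controlled-`S` gadget of slot `s`, wire `i`. [folklore] -/
def rawGS (s i : ℕ) : List RawGate :=
  toffoliT.map (interp (cw ℓ s (tOf ℓ + i), rVal ℓ i, ℓ)) ++
    ((false, 1, [ℓ]) :: toffoliT.map (interp (cw ℓ s (tOf ℓ + i), rVal ℓ i, ℓ)))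

/-- Raw controlled-`T` gadget of slot `s`, wire `i`. [folklore] -/
def rawGT (s i : ℕ) : List RawGate :=
  toffoliT.map (interp (cw ℓ s (2 * tOf ℓ + i), rVal ℓ i, ℓ)) ++
    ((false, 2, [ℓ]) :: toffoliT.map (interp (cw ℓ s (2 * tOf ℓ + i), rVal ℓ i, ℓ)))

/-- Raw controlled-`CNOT` gadget of slot `s`, wires `i → j` (empty on the diagonal). [folklore] -/
def rawGC (s i j : ℕ) : List RawGate :=
  if i = j then [] else toffoliT.map (interp (cw ℓ s (3 * tOf ℓ + i * tOf ℓ + j), rVal ℓ i, rVal ℓ j))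

/-- Raw slot `s`. [folklore] -/
def rawSlot (s : ℕ) : List RawGate :=
  (List.range (tOf ℓ)).flatMap (rawGH ℓ s) ++ ((List.range (tOf ℓ)).flatMap (rawGS ℓ s) ++
    ((List.range (tOf ℓ)).flatMap (rawGT ℓ s) ++
      (List.range (tOf ℓ)).flatMap fun i => (List.range (tOf ℓ)).flatMap (rawGC ℓ s i)))

/-- The raw gate list of the executor. [folklore] -/
def rawCirc : List RawGate := if Fits ℓ then (List.range (tOf ℓ)).flatMap (rawSlot ℓ) else []

variable {ℓ}

/-- The value of `cctl`. [folklore] -/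
@[simp] theorem val_cctl (hF : Fits ℓ) (s : Fin (tOf ℓ)) (δ : Cand (tOf ℓ)) : (cctl hF s δ : ℕ) = cw ℓ s δ.col := rfl

/-- The raw gadgets are the gadgets. [folklore] -/
theorem map_toRaw_gadget (hF : Fits ℓ) (s : Fin (tOf ℓ)) (δ : Cand (tOf ℓ)) :
    (gadget hF s δ).map QGate.toRaw =
      match δ with
      | .H i => rawGH ℓ s i
      | .S i => rawGS ℓ s i
      | .T i => rawGT ℓ s i
      | .C i j _ => rawGC ℓ s i j := by
  cases δ with
  | H i =>
    show _ = rawGH ℓ s i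
    rw [gadget, map_toRaw_chWord _ _ _ 0, rawGH, val_cctl, val_R]; rfl
  | S i =>
    show _ = rawGS ℓ s i
    rw [gadget, List.map_append, List.map_cons, map_toRaw_toffoliWord, rawGS, val_cctl, val_R]; rfl
  | T i =>
    show _ = rawGT ℓ s i
    rw [gadget, List.map_append, List.map_cons, map_toRaw_toffoliWord, rawGT, val_cctl, val_R]; rfl
  | C i j h =>
    show _ = rawGC ℓ s i j
    rw [gadget, map_toRaw_toffoliWord, rawGC, val_cctl, val_R, val_R, if_neg (fun e => h (Fin.ext e))]
    rfl

/-- `finRange` sums are `range` sums. [folklore] -/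
theorem flatMap_finRange_eq {α : Type*} (t : ℕ) (F : ℕ → List α) :
    ((List.finRange t).flatMap fun i : Fin t => F i) = (List.range t).flatMap F := by
  rw [← List.map_coe_finRange_eq_range, List.flatMap_map]

/-- The raw slot is the slot. [folklore] -/
theorem map_toRaw_slotOps (hF : Fits ℓ) (s : Fin (tOf ℓ)) :
    (slotOps hF s (Cand.all (tOf ℓ))).map QGate.toRaw = rawSlot ℓ s := by
  rw [slotOps, List.map_flatMap, Cand.all, List.flatMap_append, List.flatMap_append, List.flatMap_append,
    List.flatMap_map, List.flatMap_map, List.flatMap_map, rawSlot]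
  simp only [map_toRaw_gadget]
  rw [flatMap_finRange_eq _ (rawGH ℓ s), flatMap_finRange_eq _ (rawGS ℓ s), flatMap_finRange_eq _ (rawGT ℓ s),
    List.flatMap_assoc]
  congr 3
  rw [← flatMap_finRange_eq _ (fun i => (List.range (tOf ℓ)).flatMap (rawGC ℓ s i))]
  refine List.flatMap_congr fun i _ => ?_
  rw [Cand.cnots, List.flatMap_assoc, ← flatMap_finRange_eq _ (rawGC ℓ s i)]
  refine List.flatMap_congr fun j _ => ?_
  by_cases h : i = j
  · rw [dif_pos h, rawGC, if_pos (congrArg Fin.val h), List.flatMap_nil]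
  · rw [dif_neg h, List.flatMap_cons, List.flatMap_nil, List.append_nil]

/-- **The raw description of the executor circuit.** [folklore] -/
theorem rawGates_circ (ℓ : ℕ) : (circ ℓ).rawGates = rawCirc ℓ := by
  unfold circ rawCirc
  by_cases hF : Fits ℓ
  · rw [dif_pos hF, if_pos hF, QCircuit.rawGates, allOps, List.map_flatMap]
    simp only [map_toRaw_slotOps]
    exact flatMap_finRange_eq _ _
  · rw [dif_neg hF, if_neg hF]; rfl

end RawExec

/-! ### The description of the executor in polynomial time -/

section Program

open Complexity.CodeFP

variable {σ : Type} {eσ : σ → List Bool}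

/-- A `flatMap` over a range with a context, on codes. [cite: AroraBarak2009, §1.3 (bounded loops)] -/
theorem flatMapRange {β : Type} {eβ : β → List Bool} {k : σ → ℕ} {F : σ → ℕ → List β} (hk : CodeFP eσ unE k)
    (hF : CodeFP (pairE eσ natE) (rawE eβ) (fun p => F p.1 p.2)) :
    CodeFP eσ (rawE eβ) (fun c => (List.range (k c)).flatMap (F c)) :=
  (((flatten eβ).comp ((map hF).comp ((CodeFP.id eσ).pair (urange.comp hk)))).congr fun c => by
    simp [List.flatMap_def])

/-- The size parameter in binary, from the input length carried in the context. [folklore] -/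
theorem tnat_of {L : σ → ℕ} (hL : CodeFP eσ unE L) : CodeFP eσ natE (fun c => tOf (L c)) :=
  ((natSqrt.comp (natSqrt.comp (natOfUn.comp hL))).congr fun _ => rfl :)

/-- The size parameter in unary. [folklore] -/
theorem tun_of {L : σ → ℕ} (hL : CodeFP eσ unE L) : CodeFP eσ unE (fun c => tOf (L c)) :=
  ((unOfNatMin.comp (hL.pair (tnat_of hL))).congr fun c => by
    show min (tOf (L c)) (L c) = tOf (L c)
    have h1 : tOf (L c) ≤ Nat.sqrt (L c) := Nat.sqrt_le_self _
    have h2 : Nat.sqrt (L c) ≤ L c := Nat.sqrt_le_self _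
    omega :)

/-- The row width. [folklore] -/
theorem rowW_of {T : σ → ℕ} (hT : CodeFP eσ natE T) : CodeFP eσ natE (fun c => rowW (T c)) :=
  ((natAdd.comp ((natMul.comp ((const eσ 3).pair hT)).pair (natMul.comp (hT.pair hT)))).congr fun _ => rfl :)

/-- The table position `cw`. [folklore] -/
theorem cw_of {L S C : σ → ℕ} (hL : CodeFP eσ unE L) (hS : CodeFP eσ natE S) (hC : CodeFP eσ natE C) :
    CodeFP eσ natE (fun c => cw (L c) (S c) (C c)) :=
  ((natAdd.comp ((natAdd.comp ((const eσ 1).pair (natMul.comp (hS.pair (rowW_of (tnat_of hL)))))).pair hC)).congr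
    fun _ => rfl :)

/-- The simulated-wire value `rVal`. [folklore] -/
theorem rVal_of {L I : σ → ℕ} (hL : CodeFP eσ unE L) (hI : CodeFP eσ natE I) :
    CodeFP eσ natE (fun c => rVal (L c) (I c)) :=
  ((AJLCore.iteProp (P := fun c => I c = 0) (natEq.comp (hI.pair (const eσ 0))) (const eσ 0)
    (natAdd.comp ((natOfUn.comp hL).pair hI))).congr fun _ => rfl :)

/-! #### Templates on codes -/

/-- The code of three wires / of a template instruction. [folklore] -/
abbrev w3E : ℕ × ℕ × ℕ → List Bool := pairE natE (pairE natE natE)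

/-- Wire selection on codes. [folklore] -/
theorem sel_fp : CodeFP (pairE w3E natE) natE (fun q => sel q.1 q.2) := by
  have h0 : CodeFP (pairE w3E natE) natE (fun q => q.1.1) := (fst _ _).fst'
  have h1 : CodeFP (pairE w3E natE) natE (fun q => q.1.2.1) := (fst _ _).snd'.fst'
  have h2 : CodeFP (pairE w3E natE) natE (fun q => q.1.2.2) := (fst _ _).snd'.snd'
  have hx0 : CodeFP (pairE w3E natE) bitE (fun q => decide (q.2 = 0)) := (natEq.comp ((snd _ _).pair (const _ 0)) :)
  have hx1 : CodeFP (pairE w3E natE) bitE (fun q => decide (q.2 = 1)) := (natEq.comp ((snd _ _).pair (const _ 1)) :)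
  exact (AJLCore.iteProp hx0 h0 (AJLCore.iteProp hx1 h1 h2)).congr fun _ => rfl

/-- A list of two numerals, headed. [folklore] -/
theorem natListE2 {i j : σ → ℕ} (hi : CodeFP eσ natE i) (hj : CodeFP eσ natE j) :
    CodeFP eσ (listE natE) (fun a => [i a, j a]) :=
  ((listOfRaw natE).comp ((rawCons natE).comp (hi.pair ((rawSingleton natE).comp hj))) :)

/-- A list of one numeral, headed. [folklore] -/
theorem natListE1 {i : σ → ℕ} (hi : CodeFP eσ natE i) : CodeFP eσ (listE natE) (fun a => [i a]) :=
  ((listOfRaw natE).comp ((rawSingleton natE).comp hi) :)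

/-- A raw (non-oracle) gate from its numeral and headed wire list. [folklore] -/
theorem rawGate_of {n : σ → ℕ} {ws : σ → List ℕ} (hn : CodeFP eσ natE n) (hws : CodeFP eσ (listE natE) ws) :
    CodeFP eσ RawGate.E (fun a => ((false, n a, ws a) : RawGate)) :=
  (RawGate.codeFP_mk.comp ((const eσ false).pair (hn.pair hws)) :)

/-- The template interpreter on codes. [folklore] -/
theorem interp_fp : CodeFP (pairE w3E w3E) RawGate.E (fun p => interp p.1 p.2) := by
  have hx : CodeFP (pairE w3E w3E) natE (fun p => sel p.1 p.2.2.1) := (sel_fp.comp ((fst _ _).pair (snd _ _).snd'.fst') :)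
  have hy : CodeFP (pairE w3E w3E) natE (fun p => sel p.1 p.2.2.2) := (sel_fp.comp ((fst _ _).pair (snd _ _).snd'.snd') :)
  have ho : CodeFP (pairE w3E w3E) natE (fun p => p.2.1) := (snd _ _).fst'
  have h3 : CodeFP (pairE w3E w3E) bitE (fun p => decide (p.2.1 = 3)) := (natEq.comp (ho.pair (const _ 3)) :)
  exact (AJLCore.iteProp h3 (rawGate_of (const _ 3) (natListE2 hx hy)) (rawGate_of ho (natListE1 hx))).congr fun _ => rfl

/-- Mapping the interpreter over a fixed template. [folklore] -/
theorem mapInterp_of (T : List Tmpl) {W : σ → ℕ × ℕ × ℕ} (hW : CodeFP eσ w3E W) :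
    CodeFP eσ (rawE RawGate.E) (fun c => T.map (interp (W c))) :=
  (((map interp_fp).comp (hW.pair (const eσ T))).congr fun _ => rfl :)

/-! #### The gadgets, slots and the whole description on codes -/

/-- Context `(ℓ, s)`: unary input length, binary slot. [folklore] -/
abbrev c2E : ℕ × ℕ → List Bool := pairE unE natE

/-- Context `((ℓ, s), i)`. [folklore] -/
abbrev c3E : (ℕ × ℕ) × ℕ → List Bool := pairE c2E natE

/-- Context `(((ℓ, s), i), j)`. [folklore] -/
abbrev c4E : ((ℕ × ℕ) × ℕ) × ℕ → List Bool := pairE c3E natE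

/-- The raw controlled-`H` gadget on codes. [folklore] -/
theorem rawGH_fp : CodeFP c3E (rawE RawGate.E) (fun c => rawGH c.1.1 c.1.2 c.2) := by
  have hL : CodeFP c3E unE (fun c => c.1.1) := (fst _ _).fst'
  have hS : CodeFP c3E natE (fun c => c.1.2) := (fst _ _).snd'
  have hI : CodeFP c3E natE (fun c => c.2) := snd _ _
  exact (mapInterp_of chT ((cw_of hL hS hI).pair ((rVal_of hL hI).pair (const _ 0)))).congr fun _ => rfl

/-- The raw controlled-phase gadgets on codes (`o = 1`: `S`, column offset `t`; `o = 2`: `T`,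
column offset `2t`). [folklore] -/
theorem rawGST_fp (o m : ℕ) : CodeFP c3E (rawE RawGate.E) (fun c =>
    toffoliT.map (interp (cw c.1.1 c.1.2 (m * tOf c.1.1 + c.2), rVal c.1.1 c.2, c.1.1)) ++
      ((false, o, [c.1.1]) :: toffoliT.map (interp (cw c.1.1 c.1.2 (m * tOf c.1.1 + c.2), rVal c.1.1 c.2, c.1.1)))) := by
  have hL : CodeFP c3E unE (fun c => c.1.1) := (fst _ _).fst'
  have hS : CodeFP c3E natE (fun c => c.1.2) := (fst _ _).snd'
  have hI : CodeFP c3E natE (fun c => c.2) := snd _ _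
  have hC : CodeFP c3E natE (fun c => m * tOf c.1.1 + c.2) := (natAdd.comp ((natMul.comp ((const _ m).pair (tnat_of hL))).pair hI) :)
  have hA : CodeFP c3E (rawE RawGate.E) (fun c => toffoliT.map (interp (cw c.1.1 c.1.2 (m * tOf c.1.1 + c.2), rVal c.1.1 c.2, c.1.1))) :=
    mapInterp_of toffoliT ((cw_of hL hS hC).pair ((rVal_of hL hI).pair (natOfUn.comp hL)))
  have hg : CodeFP c3E RawGate.E (fun c => ((false, o, [c.1.1]) : RawGate)) := rawGate_of (const _ o) (natListE1 (natOfUn.comp hL))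
  exact ((rawAppend _).comp (hA.pair ((rawCons _).comp (hg.pair hA))) :)

/-- The raw controlled-`S` gadget on codes. [folklore] -/
theorem rawGS_fp : CodeFP c3E (rawE RawGate.E) (fun c => rawGS c.1.1 c.1.2 c.2) :=
  (rawGST_fp 1 1).congr fun c => by simp only [rawGS, one_mul]

/-- The raw controlled-`T` gadget on codes. [folklore] -/
theorem rawGT_fp : CodeFP c3E (rawE RawGate.E) (fun c => rawGT c.1.1 c.1.2 c.2) :=
  (rawGST_fp 2 2).congr fun c => by simp only [rawGT]

/-- The raw controlled-`CNOT` gadget on codes. [folklore] -/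
theorem rawGC_fp : CodeFP c4E (rawE RawGate.E) (fun c => rawGC c.1.1.1 c.1.1.2 c.1.2 c.2) := by
  have hL : CodeFP c4E unE (fun c => c.1.1.1) := (fst _ _).fst'.fst'
  have hS : CodeFP c4E natE (fun c => c.1.1.2) := (fst _ _).fst'.snd'
  have hI : CodeFP c4E natE (fun c => c.1.2) := (fst _ _).snd'
  have hJ : CodeFP c4E natE (fun c => c.2) := snd _ _
  have hC : CodeFP c4E natE (fun c => 3 * tOf c.1.1.1 + c.1.2 * tOf c.1.1.1 + c.2) :=
    (natAdd.comp ((natAdd.comp ((natMul.comp ((const _ 3).pair (tnat_of hL))).pair (natMul.comp (hI.pair (tnat_of hL))))).pair hJ) :)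
  have hA : CodeFP c4E (rawE RawGate.E) (fun c => toffoliT.map (interp (cw c.1.1.1 c.1.1.2 (3 * tOf c.1.1.1 + c.1.2 * tOf c.1.1.1 + c.2),
      rVal c.1.1.1 c.1.2, rVal c.1.1.1 c.2))) := mapInterp_of toffoliT ((cw_of hL hS hC).pair ((rVal_of hL hI).pair (rVal_of hL hJ)))
  have hE : CodeFP c4E bitE (fun c => decide (c.1.2 = c.2)) := (natEq.comp (hI.pair hJ) :)
  exact (AJLCore.iteProp hE (const _ []) hA).congr fun _ => rfl

/-- The raw slot on codes. [folklore] -/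
theorem rawSlot_fp : CodeFP c2E (rawE RawGate.E) (fun c => rawSlot c.1 c.2) := by
  have ht2 : CodeFP c2E unE (fun c => tOf c.1) := tun_of (fst _ _)
  have ht3 : CodeFP c3E unE (fun c => tOf c.1.1) := tun_of (fst _ _).fst'
  have hH : CodeFP c2E (rawE RawGate.E) (fun c => (List.range (tOf c.1)).flatMap (rawGH c.1 c.2)) :=
    flatMapRange (eσ := c2E) (F := fun (c : ℕ × ℕ) (i : ℕ) => rawGH c.1 c.2 i) ht2 rawGH_fp
  have hS : CodeFP c2E (rawE RawGate.E) (fun c => (List.range (tOf c.1)).flatMap (rawGS c.1 c.2)) :=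
    flatMapRange (eσ := c2E) (F := fun (c : ℕ × ℕ) (i : ℕ) => rawGS c.1 c.2 i) ht2 rawGS_fp
  have hT : CodeFP c2E (rawE RawGate.E) (fun c => (List.range (tOf c.1)).flatMap (rawGT c.1 c.2)) :=
    flatMapRange (eσ := c2E) (F := fun (c : ℕ × ℕ) (i : ℕ) => rawGT c.1 c.2 i) ht2 rawGT_fp
  have hCi : CodeFP c3E (rawE RawGate.E) (fun c => (List.range (tOf c.1.1)).flatMap (rawGC c.1.1 c.1.2 c.2)) :=
    flatMapRange (eσ := c3E) (F := fun (c : (ℕ × ℕ) × ℕ) (j : ℕ) => rawGC c.1.1 c.1.2 c.2 j) ht3 rawGC_fp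
  have hC : CodeFP c2E (rawE RawGate.E) (fun c => (List.range (tOf c.1)).flatMap fun i =>
      (List.range (tOf c.1)).flatMap (rawGC c.1 c.2 i)) :=
    flatMapRange (eσ := c2E) (F := fun (c : ℕ × ℕ) (i : ℕ) => (List.range (tOf c.1)).flatMap (rawGC c.1 c.2 i)) ht2 hCi
  have h : CodeFP c2E (rawE RawGate.E) (fun c => (List.range (tOf c.1)).flatMap (rawGH c.1 c.2) ++
      ((List.range (tOf c.1)).flatMap (rawGS c.1 c.2) ++ ((List.range (tOf c.1)).flatMap (rawGT c.1 c.2) ++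
        (List.range (tOf c.1)).flatMap fun i => (List.range (tOf c.1)).flatMap (rawGC c.1 c.2 i)))) :=
    ((rawAppend _).comp (hH.pair ((rawAppend _).comp (hS.pair ((rawAppend _).comp (hT.pair hC))))) :)
  exact h.congr fun c => (rfl : _ = rawSlot c.1 c.2)

/-- The table-fits test on codes. [folklore] -/
theorem fits_fp : CodeFP unE bitE (fun ℓ => decide (Fits ℓ)) :=
  ((natLe.comp ((natAdd.comp ((const _ 1).pair (natMul.comp ((tnat_of (CodeFP.id unE)).pair
    (rowW_of (tnat_of (CodeFP.id unE))))))).pair natOfUn)).congr fun _ => rfl :)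

/-- **The raw gate list of the executor on codes.** [cite: AroraBarak2009, §6.2 (P-uniform families: the description is printed in polynomial time)] -/
theorem rawCirc_fp : CodeFP unE (rawE RawGate.E) rawCirc := by
  have hall : CodeFP unE (rawE RawGate.E) (fun ℓ => (List.range (tOf ℓ)).flatMap (rawSlot ℓ)) :=
    flatMapRange (eσ := unE) (F := fun (ℓ s : ℕ) => rawSlot ℓ s) (tun_of (CodeFP.id unE)) rawSlot_fp
  exact (AJLCore.iteProp fits_fp hall (const _ [])).congr fun ℓ => by rw [rawCirc]

/-- The ancilla count in unary. [folklore] -/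
theorem anc_fp : CodeFP unE unE anc := ((unSucc.comp (tun_of (CodeFP.id unE))).congr fun _ => rfl :)

/-- **The description of the executor family in polynomial time.** [cite: AroraBarak2009, §6.2 (P-uniform families)] -/
theorem desc_codeFP :
    CodeFP unE (QCircuit.sigmaEncode (G := cliffordT)) (fun ℓ => (⟨ℓ, anc ℓ, circ ℓ⟩ : Σ n m : ℕ, QCircuit cliffordT (n + m))) := by
  have h : CodeFP unE (pairE natE (pairE unE (rawE RawGate.E))) (fun ℓ => (ℓ, anc ℓ, rawCirc ℓ)) :=
    natOfUn.pair (anc_fp.pair rawCirc_fp)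
  exact h.recodeOut fun ℓ => by
    rw [QCircuit.sigmaEncode_eq, QCircuit.encode_eq_rawE, rawGates_circ]
    rfl

/-- **The universal executor family is polynomial-time uniform.** [cite: AroraBarak2009, §6.2 (P-uniform circuit families), Thm. 6.15] -/
theorem family_isUniform : family.IsUniform := desc_codeFP.polyTimeComputable

end Program

end UExec

end Literature.Computability.QuantumComplexity

end
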